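import Summits.NavierStokesRegularity.NavierStokesRegularity.Theorems.ScenarioCensusDeviatorMeter
import Summits.NavierStokesRegularity.NavierStokesRegularity.Theorems.ScenarioCensusRoughnessMeter
import Summits.NavierStokesRegularity.NavierStokesRegularity.Theorems.ScenarioCensusDiffusionMeterRows
import HarnessLib

/-!
# LINE «deviator-meter» port, part 2/4: §D the stress form of the nonlinearity and the deviatoric slice bound; §E the window engine with a backward-end cutoff

Re-homed for the scenario census (typer seat ns-census-typer-1 g8; cells of ns-idea-2 g14 LINE g14-4 «deviator-meter», rev 2 528544c56f6257b6 = rev 1 + one nesting (ref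
ns-census-ref §15.23 / §15.27 ✓, critic idea-crit-3 PASS — no price), members of block A2 booked by the lead since census v1.79 / v1.80; this port makes the decided cells
TREE-decided): VERBATIM PORT of `pub/ideators/ns-idea-2/lines/deviator-meter/line-deviator-meter.rev2.lean` sha16 528544c56f6257b6 (1325 l., lean check rc 0, 0 sorry), split
for the 400-line rule into `ScenarioCensusDeviatorMeter` (§A–§C) → `…DeviatorMeterStress` (§D–§E) → `…DeviatorMeterEngine` (§F–§G) → `…DeviatorMeterRows` (§H–§J + census
KEYS).  Lean text VERBATIM in namespace `…Theorems.ScenarioCensus.DeviatorMeter` (the line's `…Lines.DeviatorMeter` re-homed); port edits: `local notation "E3"` →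
`abbrev E3` (typer lint: no notation in port files), `@[conjecture]` on the OPEN rows `Row_A2dn` / `Row_A2dl` (typed only), one-line docstrings added where missing (gate lint);
lemmas and the constant `kernelConst` that the line shares VERBATIM with the landed roughness-meter / diffusion-meter ports are taken BY NAME (listed below).  Statements
untouched.

No census VALUE is moved here (the cells become TREE-decided by name; booking is the lead's); NS regularity is NOT proved; (L′) ⟨10661⟩ is untouched; no summit
statement is proved by this file. Lemmas that restate already-landed tree declarations are taken BY NAME (gate lint `dedup.landed`): `kernelConst` = `RoughnessMeter.kernelConst`, `kernelConst_pos` = `RoughnessMeter.kernelConst_pos`, `kernelConst_spec` = `RoughnessMeter.kernelConst_spec`, `integrableOn_sub_rpow` = `RoughnessMeter.integrableOn_sub_rpow`, `setIntegral_sub_rpow` = `RoughnessMeter.setIntegral_sub_rpow`, `eq_zero_of_small_backward_end` = `DiffusionMeter.eq_zero_of_small_backward_end`.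
-/

-- the summit and its single problem share the name `NavierStokesRegularity` (D-0017 nested layout)
set_option linter.dupNamespace false

noncomputable section

open Set Function Filter Topology Metric MeasureTheory
open scoped RealInnerProductSpace

namespace Summit.NavierStokesRegularity.NavierStokesRegularity.Theorems.ScenarioCensus.DeviatorMeter

open Literature.Analysis Literature.Analysis.FluidPDE
open Summit.NavierStokesRegularity.NavierStokesRegularity.Theorems.SimilarityEnstrophy
  (typeI_ancient_eq_zero_of_rate_lt_one)
open Summit.NavierStokesRegularity.NavierStokesRegularity.Theorems.SymmetryModuliCountSymmetricLiouville
  (vanishes_of_vanishes_before)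

/-! ## D. The stress form of the nonlinearity and the deviatoric slice bound

By the heat semigroup (tree `heatExtension_oseenSlice`), `N_σ[f,f] = e^{(σ/2)Δ} N_{σ/2}[f,f]`, and
moving the Gaussian onto the data (Fubini + translation + bilinearity in a frame):
`N_σ[f,f](x) = ∫ ∑ⱼₖ (e^{(σ/2)Δ}(fⱼfₖ))(w) · K(σ/2, x-w)[eⱼ,eₖ] dw` — the nonlinearity at lag `σ`
only sees the Reynolds stress COARSE-GRAINED at scale `σ/2`; by the lever, only its deviator. -/

/-- **Stress form of the Oseen slice.** -/
theorem oseenSlice_eq_integral_stress {f : E3 → E3} (hfc : Continuous f) {Mf : ℝ}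
    (hMf : ∀ z, ‖f z‖ ≤ Mf) {σ : ℝ} (hσ : 0 < σ) (x : E3) :
    oseenSlice σ f f x = ∫ w, ∑ j, ∑ k,
      UnboundedOperators.heatExtension (stressFun f j k) (σ / 2) w •
        oseenKernel (σ / 2) (x - w) (frame j) (frame k) := by
  set s : ℝ := σ / 2 with hs
  have hs0 : 0 < s := by positivity
  have hss : s + s = σ := by rw [hs]; ring
  have hfm : Measurable f := hfc.measurable
  have hMf0 : 0 ≤ Mf := (norm_nonneg _).trans (hMf 0)
  -- (1) output-side semigroup (tree) and the heat average written out
  rw [← hss, ← heatExtension_oseenSlice hs0 hs0 hfm hfm hMf hMf x,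
    UnboundedOperators.heatExtension_apply]
  -- (2) translate the inner slice so that the kernel sits at `x - w`
  have htr : ∀ y' : E3, oseenSlice s f f (x - y') =
      ∫ w, oseenKernel s (x - w) (f (w - y')) (f (w - y')) := by
    intro y'
    set g : E3 → E3 := fun w => oseenKernel s (x - w) (f (w - y')) (f (w - y')) with hg
    have e : (fun y => oseenKernel s (x - y' - y) (f y) (f y)) = fun y => g (y + y') := by
      funext y
      simp only [hg, add_sub_cancel_right]
      congr 1
      abel
    rw [oseenSlice_apply, e, integral_add_right_eq_self g y']
  have h3 : (fun y' => UnboundedOperators.heatKernel s y' • oseenSlice s f f (x - y')) =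
      fun y' => ∫ w, UnboundedOperators.heatKernel s y' •
        oseenKernel s (x - w) (f (w - y')) (f (w - y')) := by
    funext y'
    rw [htr y', integral_smul]
  rw [h3]
  -- (3) Fubini
  have he : (Module.finrank ℝ E3 : ℝ) < 2 * 2 := by
    rw [finrank_euclideanSpace_fin]; norm_num
  have hw : Integrable (fun z : E3 => (s + ‖z‖ ^ 2) ^ (-(2 : ℝ))) :=
    integrable_add_norm_sq_rpow_neg he hs0
  have hwx : Integrable (fun w : E3 => (s + ‖x - w‖ ^ 2) ^ (-(2 : ℝ))) := hw.comp_sub_left x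
  have hG : Integrable (UnboundedOperators.heatKernel (E := E3) s) :=
    UnboundedOperators.integrable_heatKernel_holds hs0
  have hInt : Integrable (uncurry fun (y' : E3) (w : E3) => UnboundedOperators.heatKernel s y' •
      oseenKernel s (x - w) (f (w - y')) (f (w - y'))) (volume.prod volume) := by
    have hm : Measurable (uncurry fun (y' : E3) (w : E3) => UnboundedOperators.heatKernel s y' •
        oseenKernel s (x - w) (f (w - y')) (f (w - y'))) := by
      refine Measurable.smul ((UnboundedOperators.continuous_heatKernel s).measurable.comp
        measurable_fst) ?_
      exact Measurable.oseenKernel_comp measurable_const (measurable_const.sub measurable_snd)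
        (hfm.comp (measurable_snd.sub measurable_fst)) (hfm.comp (measurable_snd.sub measurable_fst))
    have hprod : Integrable (fun p : E3 × E3 => UnboundedOperators.heatKernel s p.1 *
        ((RoughnessMeter.kernelConst * Mf * Mf) * (s + ‖x - p.2‖ ^ 2) ^ (-(2 : ℝ)))) (volume.prod volume) :=
      hG.mul_prod (hwx.const_mul _)
    refine hprod.mono' hm.aestronglyMeasurable (Eventually.of_forall fun p => ?_)
    rcases p with ⟨y', w⟩
    simp only [uncurry]
    have hGp := (UnboundedOperators.heatKernel_pos hs0 y').le
    rw [norm_smul, Real.norm_of_nonneg hGp]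
    refine mul_le_mul_of_nonneg_left ?_ hGp
    have hwnn : 0 ≤ (s + ‖x - w‖ ^ 2) ^ (-(2 : ℝ)) := Real.rpow_nonneg (by positivity) _
    have hCK := RoughnessMeter.kernelConst_pos
    calc ‖oseenKernel s (x - w) (f (w - y')) (f (w - y'))‖
        ≤ RoughnessMeter.kernelConst * (s + ‖x - w‖ ^ 2) ^ (-(2 : ℝ)) * ‖f (w - y')‖ * ‖f (w - y')‖ :=
          RoughnessMeter.kernelConst_spec hs0 _ _ _
      _ ≤ RoughnessMeter.kernelConst * (s + ‖x - w‖ ^ 2) ^ (-(2 : ℝ)) * Mf * Mf := by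
          have ha : 0 ≤ RoughnessMeter.kernelConst * (s + ‖x - w‖ ^ 2) ^ (-(2 : ℝ)) := mul_nonneg hCK.le hwnn
          exact mul_le_mul (mul_le_mul_of_nonneg_left (hMf _) ha) (hMf _) (norm_nonneg _)
            (mul_nonneg ha hMf0)
      _ = RoughnessMeter.kernelConst * Mf * Mf * (s + ‖x - w‖ ^ 2) ^ (-(2 : ℝ)) := by ring
  rw [integral_integral_swap hInt]
  -- (4) the inner integral at fixed `w`: expand in the frame and recognise the heat averages
  refine integral_congr_ae (Eventually.of_forall fun w => ?_)
  have hexp : ∀ y' : E3, UnboundedOperators.heatKernel s y' •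
      oseenKernel s (x - w) (f (w - y')) (f (w - y')) =
      ∑ j, ∑ k, (UnboundedOperators.heatKernel s y' * stressFun f j k (w - y')) •
        oseenKernel s (x - w) (frame j) (frame k) := by
    intro y'
    rw [oseenKernel_eq_sum_inner_smul frame s (x - w) (f (w - y')) (f (w - y')), Finset.smul_sum]
    refine Finset.sum_congr rfl fun j _ => ?_
    rw [Finset.smul_sum]
    refine Finset.sum_congr rfl fun k _ => ?_
    rw [smul_smul]
    rfl
  simp_rw [hexp]
  have hIjk : ∀ j k : Fin 3, Integrable (fun y' : E3 =>
      (UnboundedOperators.heatKernel s y' * stressFun f j k (w - y')) •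
        oseenKernel s (x - w) (frame j) (frame k)) := by
    intro j k
    have h1 : Integrable (fun y' : E3 => UnboundedOperators.heatKernel s y' * stressFun f j k (w - y')) := by
      have := UnboundedOperators.integrable_heatKernel_smul_of_bound (F := ℝ)
        (continuous_stressFun hfc j k) (C := Mf * Mf)
        (fun z => by rw [Real.norm_eq_abs]; exact abs_stressFun_le hMf hMf j k z) hs0 w
      simpa only [smul_eq_mul] using this
    exact h1.smul_const _
  rw [integral_finsetSum _ (fun j _ => integrable_finsetSum _ (fun k _ => hIjk j k))]
  refine Finset.sum_congr rfl fun j _ => ?_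
  rw [integral_finsetSum _ (fun k _ => hIjk j k)]
  refine Finset.sum_congr rfl fun k _ => ?_
  exact integral_smul_const _ _

/-- The meter entry is the frame coefficient minus an isotropic part:
`D[f](s)ⱼₖ = e^{sΔ}(fⱼfₖ) - δⱼₖ e^{sΔ}(|f|²/3)`. -/
theorem heatExtension_devFun_eq {f : E3 → E3} (hfc : Continuous f) {Mf : ℝ} (hMf : ∀ z, ‖f z‖ ≤ Mf)
    {s : ℝ} (hs : 0 < s) (j k : Fin 3) (w : E3) :
    UnboundedOperators.heatExtension (devFun f j k) s w =
      UnboundedOperators.heatExtension (stressFun f j k) s w -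
        if j = k then UnboundedOperators.heatExtension (fun z => ‖f z‖ ^ 2 / 3) s w else 0 := by
  have hMf0 : 0 ≤ Mf := (norm_nonneg _).trans (hMf 0)
  by_cases hjk : j = k
  · simp only [hjk, if_true]
    have e : devFun f k k = fun z => stressFun f k k z - ‖f z‖ ^ 2 / 3 := by
      funext z; simp [devFun, stressFun]
    rw [e]
    have hhc : Continuous (fun z : E3 => ‖f z‖ ^ 2 / 3) := (hfc.norm.pow 2).div_const 3
    exact UnboundedOperators.heatExtension_sub_of_bound (g := stressFun f k k)
      (h := fun z => ‖f z‖ ^ 2 / 3) (continuous_stressFun hfc k k)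
      hhc (Cg := Mf * Mf) (Ch := Mf * Mf / 3)
      (fun z => by rw [Real.norm_eq_abs]; exact abs_stressFun_le hMf hMf k k z)
      (fun z => by
        show ‖‖f z‖ ^ 2 / 3‖ ≤ Mf * Mf / 3
        rw [Real.norm_of_nonneg (by positivity : (0:ℝ) ≤ ‖f z‖ ^ 2 / 3)]
        exact div_le_div_of_nonneg_right (norm_sq_le_mul hMf hMf z) (by norm_num)) hs w
  · simp only [hjk, if_false, sub_zero]
    congr 1
    funext z
    simp [devFun, stressFun, hjk]

/-- **The deviatoric slice bound (the engine's kernel estimate).**  For a continuous bounded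
slice `f` and a lag `σ > 0`: if the coarse-grained deviatoric stress at scale `σ/2` is entrywise
`≤ B`, then `‖N_σ[f,f](x)‖ ≤ 9 C_K I · B · (σ/2)^{-1/2}` — NO amplitude of `f` enters. -/
theorem norm_oseenSlice_le_of_dev {f : E3 → E3} (hfc : Continuous f) {Mf : ℝ}
    (hMf : ∀ z, ‖f z‖ ≤ Mf) {σ : ℝ} (hσ : 0 < σ) {B : ℝ} (hB0 : 0 ≤ B)
    (hB : ∀ w j k, |UnboundedOperators.heatExtension (devFun f j k) (σ / 2) w| ≤ B) (x : E3) :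
    ‖oseenSlice σ f f x‖ ≤ 9 * CI * B * (σ / 2) ^ (-(1 : ℝ) / 2) := by
  rw [oseenSlice_eq_integral_stress hfc hMf hσ x]
  set s : ℝ := σ / 2 with hs
  have hs0 : 0 < s := by positivity
  have hCK := RoughnessMeter.kernelConst_pos
  have hpt : ∀ w, ‖∑ j, ∑ k, UnboundedOperators.heatExtension (stressFun f j k) s w •
      oseenKernel s (x - w) (frame j) (frame k)‖ ≤ 9 * RoughnessMeter.kernelConst * B * (s + ‖x - w‖ ^ 2) ^ (-(2 : ℝ)) := by
    intro w
    set p : ℝ := UnboundedOperators.heatExtension (fun z => ‖f z‖ ^ 2 / 3) s w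
    rw [← sum_sub_diag_smul_oseenKernel hs0 (x - w) _ p]
    have hwnn : 0 ≤ (s + ‖x - w‖ ^ 2) ^ (-(2 : ℝ)) := Real.rpow_nonneg (by positivity) _
    calc ‖∑ j, ∑ k, (UnboundedOperators.heatExtension (stressFun f j k) s w - if j = k then p else 0) •
            oseenKernel s (x - w) (frame j) (frame k)‖
        ≤ ∑ j, ∑ k, ‖(UnboundedOperators.heatExtension (stressFun f j k) s w - if j = k then p else 0) •
            oseenKernel s (x - w) (frame j) (frame k)‖ :=
          (norm_sum_le _ _).trans (Finset.sum_le_sum fun j _ => norm_sum_le _ _)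
      _ ≤ ∑ j : Fin 3, ∑ k : Fin 3, B * (RoughnessMeter.kernelConst * (s + ‖x - w‖ ^ 2) ^ (-(2 : ℝ))) := by
          refine Finset.sum_le_sum fun j _ => Finset.sum_le_sum fun k _ => ?_
          rw [norm_smul, Real.norm_eq_abs]
          have hdev : |UnboundedOperators.heatExtension (stressFun f j k) s w - if j = k then p else 0| ≤ B := by
            rw [← heatExtension_devFun_eq hfc hMf hs0 j k w]; exact hB w j k
          refine mul_le_mul hdev ?_ (norm_nonneg _) hB0
          have h := RoughnessMeter.kernelConst_spec hs0 (x - w) (frame j) (frame k)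
          rw [norm_frame, norm_frame, mul_one, mul_one] at h
          exact h
      _ = 9 * RoughnessMeter.kernelConst * B * (s + ‖x - w‖ ^ 2) ^ (-(2 : ℝ)) := by
          simp only [Finset.sum_const, Finset.card_univ, Fintype.card_fin]
          ring
  have he : (Module.finrank ℝ E3 : ℝ) < 2 * 2 := by
    rw [finrank_euclideanSpace_fin]; norm_num
  have hw : Integrable (fun z : E3 => (s + ‖z‖ ^ 2) ^ (-(2 : ℝ))) :=
    integrable_add_norm_sq_rpow_neg he hs0
  have hwx : Integrable (fun w : E3 => (s + ‖x - w‖ ^ 2) ^ (-(2 : ℝ))) := hw.comp_sub_left x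
  refine (norm_integral_le_of_norm_le (hwx.const_mul (9 * RoughnessMeter.kernelConst * B))
    (Eventually.of_forall hpt)).trans ?_
  rw [MeasureTheory.integral_const_mul]
  have hsub : ∫ w : E3, (s + ‖x - w‖ ^ 2) ^ (-(2 : ℝ)) = ∫ z : E3, (s + ‖z‖ ^ 2) ^ (-(2 : ℝ)) :=
    integral_sub_left_eq_self (fun z : E3 => (s + ‖z‖ ^ 2) ^ (-(2 : ℝ))) volume x
  rw [hsub, integral_add_norm_sq_rpow_neg hs0 2, finrank_euclideanSpace_fin]
  have e : ((3 : ℕ) : ℝ) / 2 - 2 = -(1 : ℝ) / 2 := by push_cast; ring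
  rw [e]
  unfold CI kernelMass
  apply le_of_eq
  ring

/-! ## E. The window engine (with a backward-end cutoff `T₀ ≤ 0`) -/

/-- The Oseen integral equation over the memory window `(2t, t)`. -/
theorem window_identity {C : ℝ} {u : ℝ → E3 → E3} (hu : IsTypeIAncientMild C u) {t : ℝ}
    (ht : t < 0) (x : E3) :
    u t x = heatFlow (u (2 * t)) (t - 2 * t) x -
      ∫ τ in Ioo (2 * t) t, oseenSlice (t - τ) (u τ) (u τ) x := by
  have h2t : 2 * t < t := by linarith
  rw [hu.mild_eq_oseenKernel h2t ht x]
  simp only [oseenSlice_apply]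

/-- **Window bound.**  Free part by the heat maximum principle from the slice `2t`, Duhamel part
by a pointwise integrable majorant `g` of the slices. -/
theorem window_bound {C : ℝ} {u : ℝ → E3 → E3} (hu : IsTypeIAncientMild C u) {T₀ : ℝ}
    (hT₀ : T₀ ≤ 0) {t : ℝ} (ht : t < T₀) {M : ℝ}
    (hM : ∀ τ < T₀, ∀ y, Real.sqrt (-τ) * ‖u τ y‖ ≤ M) {g : ℝ → ℝ}
    (hgi : IntegrableOn g (Ioo (2 * t) t))
    (hg : ∀ τ ∈ Ioo (2 * t) t, ∀ x, ‖oseenSlice (t - τ) (u τ) (u τ) x‖ ≤ g τ) (x : E3) :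
    ‖u t x‖ ≤ M / Real.sqrt (-(2 * t)) + ∫ τ in Ioo (2 * t) t, g τ := by
  have ht0 : t < 0 := lt_of_lt_of_le ht hT₀
  have h2t0 : 2 * t < T₀ := by linarith
  have hs2 : 0 < Real.sqrt (-(2 * t)) := Real.sqrt_pos.2 (by linarith)
  have hb : ∀ z, ‖u (2 * t) z‖ ≤ M / Real.sqrt (-(2 * t)) := fun z => by
    rw [le_div_iff₀ hs2, mul_comm]; exact hM _ h2t0 z
  have hfree : ‖heatFlow (u (2 * t)) (t - 2 * t) x‖ ≤ M / Real.sqrt (-(2 * t)) :=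
    norm_heatFlow_le hb _ x
  have hduh : ‖∫ τ in Ioo (2 * t) t, oseenSlice (t - τ) (u τ) (u τ) x‖ ≤ ∫ τ in Ioo (2 * t) t, g τ :=
    norm_integral_le_of_norm_le hgi ((ae_restrict_iff' measurableSet_Ioo).2
      (Eventually.of_forall fun τ hτ => hg τ hτ x))
  rw [window_identity hu ht0 x]
  exact (norm_sub_le _ _).trans (add_le_add hfree hduh)

-- `integrableOn_sub_rpow`: the line restates the tree's `RoughnessMeter.integrableOn_sub_rpow`; taken BY NAME (gate lint dedup.landed).

-- `setIntegral_sub_rpow`: the line restates the tree's `RoughnessMeter.setIntegral_sub_rpow`; taken BY NAME (gate lint dedup.landed).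

/-- **Affine contraction of the amplitude.**  If every amplitude bound `M` on the backward end
`τ < T₀` improves to `q M + r` (`0 ≤ q < 1`), then the amplitude is at most `r/(1-q)` there. -/
theorem amplitude_le_of_affine_step {C : ℝ} {u : ℝ → E3 → E3} (hu : IsTypeIAncientMild C u)
    {T₀ : ℝ} (hT₀ : T₀ ≤ 0) {q r : ℝ} (hq0 : 0 ≤ q) (hq1 : q < 1) (hr : 0 ≤ r)
    (hstep : ∀ M : ℝ, 0 ≤ M → (∀ τ < T₀, ∀ y, Real.sqrt (-τ) * ‖u τ y‖ ≤ M) →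
      ∀ τ < T₀, ∀ y, Real.sqrt (-τ) * ‖u τ y‖ ≤ q * M + r) :
    ∀ τ < T₀, ∀ y, Real.sqrt (-τ) * ‖u τ y‖ ≤ r / (1 - q) := by
  have hC0 : 0 ≤ C := hu.nonneg
  have h1q : 0 < 1 - q := by linarith
  have hrq : 0 ≤ r / (1 - q) := div_nonneg hr h1q.le
  have base : ∀ τ < T₀, ∀ y, Real.sqrt (-τ) * ‖u τ y‖ ≤ C := by
    intro τ hτ y
    have hτ0 : τ < 0 := lt_of_lt_of_le hτ hT₀
    have hs : 0 < Real.sqrt (-τ) := Real.sqrt_pos.2 (by linarith)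
    have := hu.norm_le hτ0 y
    rw [le_div_iff₀ hs, mul_comm] at this
    exact this
  have iter : ∀ n : ℕ, ∀ τ < T₀, ∀ y, Real.sqrt (-τ) * ‖u τ y‖ ≤ q ^ n * C + r / (1 - q) := by
    intro n
    induction n with
    | zero =>
        intro τ hτ y
        have := base τ hτ y
        rw [pow_zero, one_mul]
        linarith
    | succ n ih =>
        intro τ hτ y
        have hMn : 0 ≤ q ^ n * C + r / (1 - q) := by positivity
        have h := hstep _ hMn ih τ hτ y
        have e : q * (q ^ n * C + r / (1 - q)) + r = q ^ (n + 1) * C + r / (1 - q) := by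
          field_simp
          ring
        linarith [e]
  intro τ hτ y
  have hlim : Tendsto (fun n : ℕ => q ^ n * C + r / (1 - q)) atTop (𝓝 (0 * C + r / (1 - q))) :=
    ((tendsto_pow_atTop_nhds_zero_of_lt_one hq0 hq1).mul_const C).add_const _
  rw [zero_mul, zero_add] at hlim
  exact ge_of_tendsto' hlim fun n => iter n τ hτ y

-- `eq_zero_of_small_backward_end`: the line restates the tree's `DiffusionMeter.eq_zero_of_small_backward_end`; taken BY NAME (gate lint dedup.landed).

/-- `1/√2 < 1`. -/
theorem one_div_sqrt_two_lt_one : 1 / Real.sqrt 2 < 1 := by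
  rw [div_lt_one (Real.sqrt_pos.2 (by norm_num : (0:ℝ) < 2))]
  have h : Real.sqrt 1 < Real.sqrt 2 := Real.sqrt_lt_sqrt (by norm_num) (by norm_num)
  rwa [Real.sqrt_one] at h

-- `sqrt_two_le_two`: `√2 ≤ 2` restates a landed Literature lemma (gate lint dedup.landed, twin in `Literature.Barriers.CriticalPhenomena…`); the line never uses it — not re-declared.

/-- `√(-(2t)) = √2 · √(-t)` for `t ≤ 0`. -/
theorem sqrt_neg_two_mul (t : ℝ) : Real.sqrt (-(2 * t)) = Real.sqrt 2 * Real.sqrt (-t) := by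
  rw [show -(2 * t) = 2 * (-t) by ring, Real.sqrt_mul (by norm_num : (0 : ℝ) ≤ 2)]

end Summit.NavierStokesRegularity.NavierStokesRegularity.Theorems.ScenarioCensus.DeviatorMeter

end
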